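import Mathlib
import HarnessLib
import Summits.HubbardSuperconductivity.HubbardSuperconductivity.Theorems.KLProgrammeKLRegimeEnginePairTransferMemberDefectRowsFactor

/-!
# Route `KLProgramme` — ENGINE child gen 8 (stmt-HubbardSuperconductivity-20437 `KLRegimeEngineV17F2`), skeleton v2 class #5 rev 3: the PINNED-KERNEL SPLIT door for the SIGNED ph rows —
# `klmd_sum_mul_eq_fibre_split`, **`klmd_norm_sum_mul_le_fibre_split`**, **`klmd_norm_sum_mul_le_fibre_split_of_le`**, `klmd_norm_sum_mul_le_pinned_split`
# (cell gate-hubbard-kl, seat hubbard-kl-k3c1-p1 g14, technique «composed-map remainder propagation»: kernel = pinned part + remainder, propagated through a class sum)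

WHY.  Located reading «(X).3-MASSES-SIGNBLIND» (k3c2-p2 g16, accepted l.5802): the member ph classes `RP RQ RS` of the class-ROWS form (rows 36/37 → 37C/37Cb) and the adjacent pair's
`D`-rows cannot be fed `kernel sup × mass` (sign-blind O(1)); their smallness is the SIGNED radial cancellation of the two-line loop, available only with the frequency–momentum sum INSIDE
the norm and the kernel product PINNED across the slice band (KLTC-INDEX v11.3 §E; SIGNED-ROWS-DESIGN §3–§4: `V(X(p,p′))V(X′(p,p′)) = A(θ_p) + R(p,p′)`, `A` pinned per RAY, `‖R‖ ≤ ε = L_V·Λ(t)`).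
This file is the model-free door for that split — a class sum `Σ_p a(p)·K(p)` (weights `a`, resolved kernel products `K`) over any fibration `θ : P → Θ` (the rays) with a pinned kernel `A : Θ → 𝕜`:
* `klmd_sum_mul_eq_fibre_split` — `Σ_p a·K = Σ_θ A(θ)·(Σ_{p ∈ fibre θ} a) + Σ_p a·(K − A∘θ)` (exact);
* **`klmd_norm_sum_mul_le_fibre_split`** — `‖Σ_p a·K‖ ≤ Σ_θ ‖A θ‖·‖Σ_{fibre θ} a‖ + ε·Σ_p ‖a‖` when `‖K p − A(θ p)‖ ≤ ε`: PINNED SUP × SIGNED FIBRE SUMS (where `∮cos 2θ = 0`, the DOS variation and the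
  Matsubara discreteness live — k3c2-p2's `klfl_lattice_forward_bubble_norm_le` / `klhl_lattice_soft_split_norm_le`) + LIPSCHITZ REMAINDER × SIGN-BLIND MASS (`…MassesFlat`);
* **`klmd_norm_sum_mul_le_fibre_split_of_le`** — the same against majorants `M ≥ ‖A‖`, `B ≥ Σ_θ‖Σ_{fibre} a‖`, `W ≥ Σ‖a‖`: `≤ M·B + ε·W`;
* `klmd_norm_sum_mul_le_pinned_split` — the one-fibre case (`A` constant): `‖Σ a·K‖ ≤ ‖A‖·‖Σ a‖ + ε·Σ‖a‖`.
Instantiation (supplier side): `P := FreqMomentum × Fin 2 × FreqMomentum` (or the pair-sum index of the class), `a :=` the indicator-weighted two-line weight of row 36's `hP/hQ/hS` literal, `K :=` the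
resolved product `V_i(t,X(p,p′))·V_i(t,X′(p,p′))`, `θ :=` the ray of `p`, `A θ :=` the product at the ray's pinned label `(ω₀, k_F(θ))`.  Pure finite-sum algebra; nothing about the model is
asserted; nothing asserts (X).3, (c), K3 or superconductivity.  0 kit · 0 lit.
-/

noncomputable section

namespace Summit.HubbardSuperconductivity.HubbardSuperconductivity.Theorems.KLRegimeSplit

set_option linter.dupNamespace false -- summit = problem name (single-conjunct summit), D-0017

open Finset

variable {𝕜 : Type*} [RCLike 𝕜] {P Θ : Type*} [Fintype P] [Fintype Θ] [DecidableEq Θ]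

/-- **Exact fibre split**: `Σ_p a·K = Σ_θ A(θ)·(Σ_{p : θ p = θ} a p) + Σ_p a p·(K p − A(θ p))`. -/
theorem klmd_sum_mul_eq_fibre_split (θ : P → Θ) (a K : P → 𝕜) (A : Θ → 𝕜) :
    ∑ p, a p * K p = ∑ t, A t * (∑ p ∈ univ.filter (fun p => θ p = t), a p) + ∑ p, a p * (K p - A (θ p)) := by
  have hfib : ∑ t, A t * (∑ p ∈ univ.filter (fun p => θ p = t), a p) = ∑ p, a p * A (θ p) := by
    have h := Finset.sum_fiberwise_of_maps_to (s := (univ : Finset P)) (t := (univ : Finset Θ)) (g := θ) (fun p _ => mem_univ _)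
      (fun p => a p * A (θ p))
    rw [← h]
    refine sum_congr rfl fun t _ => ?_
    rw [mul_sum]
    refine sum_congr rfl fun p hp => ?_
    rw [(mem_filter.1 hp).2]; ring
  rw [hfib, ← sum_add_distrib]
  exact sum_congr rfl fun p _ => by ring

/-- **`klmd_norm_sum_mul_le_fibre_split`** — pinned sup × signed fibre sums + Lipschitz remainder × sign-blind mass:
`‖Σ_p a·K‖ ≤ Σ_θ ‖A θ‖·‖Σ_{p : θ p = θ} a p‖ + ε·Σ_p ‖a p‖` whenever `‖K p − A(θ p)‖ ≤ ε` for all `p`. -/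
theorem klmd_norm_sum_mul_le_fibre_split (θ : P → Θ) (a K : P → 𝕜) (A : Θ → 𝕜) {ε : ℝ} (hε : ∀ p, ‖K p - A (θ p)‖ ≤ ε) :
    ‖∑ p, a p * K p‖ ≤ ∑ t, ‖A t‖ * ‖∑ p ∈ univ.filter (fun p => θ p = t), a p‖ + ε * ∑ p, ‖a p‖ := by
  rw [klmd_sum_mul_eq_fibre_split θ a K A]
  refine (norm_add_le _ _).trans (add_le_add ?_ ?_)
  · refine (norm_sum_le _ _).trans (sum_le_sum fun t _ => ?_)
    rw [norm_mul]
  · rw [mul_sum]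
    refine (norm_sum_le _ _).trans (sum_le_sum fun p _ => ?_)
    rw [norm_mul, mul_comm]
    exact mul_le_mul_of_nonneg_right (hε p) (norm_nonneg _)

/-- **`klmd_norm_sum_mul_le_fibre_split_of_le`** — the same against majorants: `‖A θ‖ ≤ M`, `Σ_θ ‖Σ_{fibre θ} a‖ ≤ B`, `Σ_p‖a p‖ ≤ W`, `‖K p − A(θ p)‖ ≤ ε` (`0 ≤ M`, `0 ≤ ε`) ⟹
`‖Σ_p a·K‖ ≤ M·B + ε·W`. -/
theorem klmd_norm_sum_mul_le_fibre_split_of_le (θ : P → Θ) (a K : P → 𝕜) (A : Θ → 𝕜) {ε M B W : ℝ} (hM0 : 0 ≤ M) (hε0 : 0 ≤ ε)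
    (hε : ∀ p, ‖K p - A (θ p)‖ ≤ ε) (hM : ∀ t, ‖A t‖ ≤ M) (hB : ∑ t, ‖∑ p ∈ univ.filter (fun p => θ p = t), a p‖ ≤ B) (hW : ∑ p, ‖a p‖ ≤ W) :
    ‖∑ p, a p * K p‖ ≤ M * B + ε * W := by
  refine (klmd_norm_sum_mul_le_fibre_split θ a K A hε).trans (add_le_add ?_ (mul_le_mul_of_nonneg_left hW hε0))
  calc ∑ t, ‖A t‖ * ‖∑ p ∈ univ.filter (fun p => θ p = t), a p‖ ≤ ∑ t, M * ‖∑ p ∈ univ.filter (fun p => θ p = t), a p‖ :=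
        sum_le_sum fun t _ => mul_le_mul_of_nonneg_right (hM t) (norm_nonneg _)
    _ = M * ∑ t, ‖∑ p ∈ univ.filter (fun p => θ p = t), a p‖ := by rw [mul_sum]
    _ ≤ M * B := mul_le_mul_of_nonneg_left hB hM0

omit [Fintype Θ] [DecidableEq Θ] in
/-- **The one-fibre case** (kernel pinned to a single value `A`): `‖Σ_p a·K‖ ≤ ‖A‖·‖Σ_p a p‖ + ε·Σ_p‖a p‖` whenever `‖K p − A‖ ≤ ε`. -/
theorem klmd_norm_sum_mul_le_pinned_split (a K : P → 𝕜) (A : 𝕜) {ε : ℝ} (hε : ∀ p, ‖K p - A‖ ≤ ε) :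
    ‖∑ p, a p * K p‖ ≤ ‖A‖ * ‖∑ p, a p‖ + ε * ∑ p, ‖a p‖ := by
  have h := klmd_norm_sum_mul_le_fibre_split (Θ := Unit) (fun _ => ()) a K (fun _ => A) hε
  simpa using h

end Summit.HubbardSuperconductivity.HubbardSuperconductivity.Theorems.KLRegimeSplit

end
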